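import Summits.Ventures.WeilGRH.TwistedGramCellCheck
import HarnessLib

/-!
# GRH arm (rh-explicit, venture WeilGRH): twisted format C — the SMALL-CELL checker, ODD sector
  (brick (E2b) of the χ instance lane: `hSo` and the odd far-diagonal sign facts `h0o`, `hd0o`, `hwo` of the door)

Cell `rh-explicit`, WEIL TRACK — GRH ARM (engine seat weil-grh-2 gen7).  The odd-sector twin of `TwistedGramCellCheck.lean`:
`S⁻(k,k') = M⁻(k,k') − Σ_{l∈[B,B₃)} M⁻(k,l)M⁻(k',l)/w_l − U₂⁻(k,k')`, `M⁻ = Encl.oddKernel (twistedGramCoeff χ a)`, with the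
door's rank-one direction `v(k) = −Σ_j Re χ(j)Λ(j)j^{-1/2} sin(ω_{k+1} log j)/π − Im ψ(¼+iω_{k+1}/2)/(2π) + archExpSumSin(k+1)/π`
boxed from the special-value records (`cs`, `imP`, `eS`).  ★ `hSo_of_checkCellO` delivers the door's `hSo` LITERALLY
(the odd sign facts `h0o/hd0o/hwo`: `TwistedGramCellSignsOdd.lean`).  Everything is PROVED; computable
`def`s; no named facts; RH/GRH-free.  References: H. Yoshida (1992) §6–§7 [Yoshida1992HermitianForms]; R. E. Moore (1966) [Moore1966].
-/

set_option autoImplicit false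

open Real Complex Finset
open scoped BigOperators ArithmeticFunction.vonMangoldt

namespace Summit.Ventures.WeilGRH

open Literature.NumberTheory.LFunctions Literature.NumberTheory.LFunctions.Yoshida1992
open Literature.NumberTheory.LFunctions.Yoshida1992.Encl
open Literature.Analysis.SpecialFunctions Literature.Analysis.ValidatedNumerics.NumericsMP

namespace TwistedEncl

variable {S : ℕ} {a : ℝ} {q : ℕ}

/-! ## Table-indexed odd sector box and Schur sum -/

/-- Odd-sector kernel box from the table (records at the modes `k+1`, `l+1`). [cite: Yoshida1992HermitianForms, §6 (6.10) p. 303] -/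
def oddBoxT (S : ℕ) (C : Consts) (εs : List ℤ) (LQ : MI) (tab : List IdxRec) (k l : ℕ) : MI :=
  oddBox S C εs LQ (tget tab (k + 1)) (tget tab (l + 1)) k l

/-- `oddBoxT ∋ M⁻(k,l)` for a table valid below `N > k+1, l+1`. [cite: Moore1966, Ch. 3 (interval arithmetic: inclusion property)] -/
theorem mem_oddBoxT (hS : 0 < S) (ha0 : 0 < a) {ks : List PrimeLen} (hks : PrimeData a ks) {C : Consts}
    (hC : ConstsValid S a ks C) (χ : DirichletCharacter ℂ q) {εs : List ℤ}
    (hε : ∀ i < ks.length, (χ (((ks.getD i default).val : ℕ) : ZMod q)).re = ((εs.getD i 0 : ℤ) : ℝ))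
    {LQ : MI} (hLQ : MI.mem S (Real.log q) LQ) {N : ℕ} {tab : List IdxRec} (hT : TabValid S a ks N tab)
    {k l : ℕ} (hk : k + 1 < N) (hl : l + 1 < N) :
    MI.mem S (oddKernel (twistedGramCoeff χ a) k l) (oddBoxT S C εs LQ tab k l) := by
  unfold oddKernel oddBoxT
  have h1 := (hT (k + 1) hk).1
  have h2 := (hT (k + 1) hk).2
  have h3 := (hT (l + 1) hl).1
  push_cast at h1 h2 h3
  exact mem_oddBox hS ha0 hks hC χ hε hLQ h1 h2 h3

/-- Odd Schur column sum `Σ_{c<n} M⁻(k,B+c)M⁻(k',B+c)·2^{wbits}/wN_c`. [cite: Yoshida1992HermitianForms, §7 pp. 305–312] -/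
def schurO (S : ℕ) (C : Consts) (εs : List ℤ) (LQ : MI) (tab : List IdxRec) (wbits : ℕ) (wN : List ℕ)
    (B k k' : ℕ) : ℕ → MI
  | 0 => MI.ofInt S 0
  | c + 1 => (schurO S C εs LQ tab wbits wN B k k' c).add
      ((((oddBoxT S C εs LQ tab k (B + c)).mul S (oddBoxT S C εs LQ tab k' (B + c))).mulInt ((2 : ℤ) ^ wbits)).divNat
        (wN.getD c 0))

/-- Soundness of `schurO`. [cite: Moore1966, Ch. 3 (interval arithmetic: inclusion property)] -/
theorem mem_schurO (hS : 0 < S) (ha0 : 0 < a) {ks : List PrimeLen} (hks : PrimeData a ks) {C : Consts}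
    (hC : ConstsValid S a ks C) (χ : DirichletCharacter ℂ q) {εs : List ℤ}
    (hε : ∀ i < ks.length, (χ (((ks.getD i default).val : ℕ) : ZMod q)).re = ((εs.getD i 0 : ℤ) : ℝ))
    {LQ : MI} (hLQ : MI.mem S (Real.log q) LQ) {N : ℕ} {tab : List IdxRec} (hT : TabValid S a ks N tab)
    {wbits : ℕ} {wN : List ℕ} {B k k' : ℕ} (hk : k + 1 < N) (hk' : k' + 1 < N) :
    ∀ n, B + n + 1 ≤ N → (∀ c < n, 0 < wN.getD c 0) →
      MI.mem S (∑ c ∈ Finset.range n, oddKernel (twistedGramCoeff χ a) k (B + c) *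
          oddKernel (twistedGramCoeff χ a) k' (B + c) / ((wN.getD c 0 : ℝ) / 2 ^ wbits))
        (schurO S C εs LQ tab wbits wN B k k' n)
  | 0, _, _ => by simpa [schurO] using MI.mem_ofInt S 0
  | n + 1, hn, hw => by
      rw [Finset.sum_range_succ, schurO]
      have hmN : B + n + 1 < N := by omega
      have hwn : 0 < wN.getD n 0 := hw n (by omega)
      refine MI.mem_add (mem_schurO hS ha0 hks hC χ hε hLQ hT hk hk' n (by omega) (fun c hc ↦ hw c (by omega))) ?_
      have h := MI.mem_divNat (MI.mem_mulInt (MI.mem_mul hS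
        (mem_oddBoxT hS ha0 hks hC χ hε hLQ hT hk hmN) (mem_oddBoxT hS ha0 hks hC χ hε hLQ hT hk' hmN))
        ((2 : ℤ) ^ wbits)) hwn
      refine mem_of_eq h ?_
      have hw0 : (wN.getD n 0 : ℝ) ≠ 0 := by exact_mod_cast hwn.ne'
      push_cast
      field_simp

/-! ## The rank-one direction `v(k)` and `U₂⁻` -/

/-- `Σ_{i<n} ε_i wt_i · Im cs_i` — box of `Σ_i Re χ(k_i) Λ_i sin(ω ℓ_i)` at one mode. [cite: Yoshida1992HermitianForms, §5 (5.16) p. 301] -/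
def primeSinSum (S : ℕ) (εs : List ℤ) (wts : List MI) (cs : List MC) : ℕ → MI
  | 0 => MI.ofInt S 0
  | i + 1 => (primeSinSum S εs wts cs i).add (((wts.getD i default).mulInt (εs.getD i 0)).mul S (cs.getD i default).im)

/-- Soundness of `primeSinSum`. [cite: Moore1966, Ch. 3 (interval arithmetic: inclusion property)] -/
theorem mem_primeSinSum (hS : 0 < S) {ks : List PrimeLen} {C : Consts} (hC : ConstsValid S a ks C) (εs : List ℤ)
    {n : ℤ} {R : IdxRec} (hR : OffValid S a ks n R) :
    ∀ i, i ≤ ks.length → MI.mem S (∑ j ∈ Finset.range i,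
      ((εs.getD j 0 : ℤ) : ℝ) * (ks.getD j default).wt * Real.sin (freq a n * (ks.getD j default).len))
      (primeSinSum S εs C.wts R.cs i)
  | 0, _ => by simpa [primeSinSum] using MI.mem_ofInt S 0
  | i + 1, hi => by
      rw [Finset.sum_range_succ, primeSinSum]
      have hi' : i < ks.length := hi
      have hsn : MI.mem S (Real.sin (freq a n * (ks.getD i default).len)) (R.cs.getD i default).im := by
        have := (hR.cs i hi').2
        rwa [Complex.exp_ofReal_mul_I_im] at this
      refine MI.mem_add (mem_primeSinSum hS hC εs hR i (by omega)) ?_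
      refine mem_of_eq (MI.mem_mul hS (MI.mem_mulInt (hC.wts i hi') _) hsn) ?_
      ring

/-- Box of `v(k)` (record `R` at the mode `k+1`). [cite: Yoshida1992HermitianForms, §7 pp. 305–312] -/
def vBox (S : ℕ) (C : Consts) (εs : List ℤ) (R : IdxRec) : MI :=
  ((((primeSinSum S εs C.wts R.cs C.wts.length).mul S C.invPi).mulInt (-1)).sub ((R.imP.mul S C.invPi).divNat 2)).add
    (R.eS.mul S C.invPi)

/-- The real `v(k)` of the door. [cite: Yoshida1992HermitianForms, §7 pp. 305–312] -/
noncomputable def vReal (χ : DirichletCharacter ℂ q) (a : ℝ) (k : ℕ) : ℝ :=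
  -(∑ j ∈ weilPrimeIndex a, (χ (j : ZMod q)).re * ((Λ j : ℝ) / Real.sqrt j) * Real.sin (freq a ((k : ℤ) + 1) * Real.log j)) / π -
    (Complex.digamma (1 / 4 + ((freq a ((k : ℤ) + 1) : ℝ) : ℂ) / 2 * I)).im / (2 * π) + archExpSumSin a ((k : ℤ) + 1) / π

/-- Soundness of `vBox`. [cite: Moore1966, Ch. 3 (interval arithmetic: inclusion property)] -/
theorem mem_vBox (hS : 0 < S) {ks : List PrimeLen} (hks : PrimeData a ks) {C : Consts} (hC : ConstsValid S a ks C)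
    (χ : DirichletCharacter ℂ q) {εs : List ℤ}
    (hε : ∀ i < ks.length, (χ (((ks.getD i default).val : ℕ) : ZMod q)).re = ((εs.getD i 0 : ℤ) : ℝ))
    {N : ℕ} {tab : List IdxRec} (hT : TabValid S a ks N tab) {k : ℕ} (hk : k + 1 < N) :
    MI.mem S (vReal χ a k) (vBox S C εs (tget tab (k + 1))) := by
  unfold vBox vReal
  have hR := (hT (k + 1) hk).1
  push_cast at hR
  have hsum : (∑ j ∈ weilPrimeIndex a, (χ (j : ZMod q)).re * ((Λ j : ℝ) / Real.sqrt j) *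
      Real.sin (freq a ((k : ℤ) + 1) * Real.log j)) =
      ∑ j ∈ Finset.range ks.length, ((εs.getD j 0 : ℤ) : ℝ) * (ks.getD j default).wt *
        Real.sin (freq a ((k : ℤ) + 1) * (ks.getD j default).len) := by
    have h := sum_weilPrimeIndex_eq_listSum hks
      (fun j ↦ (χ (j : ZMod q)).re * Real.sin (freq a ((k : ℤ) + 1) * Real.log j))
    rw [list_sum_map_eq_sum_range] at h
    simp only [PrimeLen.log_val] at h
    rw [show (∑ j ∈ weilPrimeIndex a, (χ (j : ZMod q)).re * ((Λ j : ℝ) / Real.sqrt j) *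
        Real.sin (freq a ((k : ℤ) + 1) * Real.log j)) = ∑ j ∈ weilPrimeIndex a, (Λ j : ℝ) / Real.sqrt j *
        ((χ (j : ZMod q)).re * Real.sin (freq a ((k : ℤ) + 1) * Real.log j)) from
      Finset.sum_congr rfl fun j _ ↦ by ring, h]
    refine Finset.sum_congr rfl fun j hj ↦ ?_
    rw [← hε j (Finset.mem_range.mp hj)]
    ring
  rw [hsum, hC.wts_len]
  have hps := mem_primeSinSum hS hC εs hR ks.length le_rfl
  refine mem_of_eq (MI.mem_add (MI.mem_sub (MI.mem_mulInt (MI.mem_mul hS hps hC.invPi) (-1))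
    (MI.mem_divNat (MI.mem_mul hS hR.imP hC.invPi) (n := 2) (by norm_num))) (MI.mem_mul hS hR.eS hC.invPi)) ?_
  push_cast
  field_simp

/-- Odd-sector cell data: block `B`, columns `[B, B₃)`, `θ`, `d₀`, weights, and the boxes `CC ∋ a(1+E(2a))`, `AOP ∋ A_op⁺`,
a rational `r8N/r8D ≥ √(8/B)`. -/
structure OddCellData where
  /-- block size -/
  B : ℕ
  /-- column cut -/
  B3 : ℕ
  /-- `θ` numerator -/
  θN : ℕ
  /-- `θ` denominator -/
  θD : ℕ
  /-- binary unit of `d₀` and the weights -/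
  wbits : ℕ
  /-- `d₀ · 2^{wbits}` -/
  d0N : ℕ
  /-- `w_{B+c} · 2^{wbits}` -/
  wN : List ℕ
  /-- box of `a(1 + weilArchDensity(2a))` -/
  CC : MI
  /-- box of `A_op⁺(a)` -/
  AOP : MI
  /-- rational `≥ √(8/B)` (numerator) -/
  r8N : ℕ
  /-- (denominator) -/
  r8D : ℕ
  deriving Repr, Inhabited

/-- The real `U₂⁻(k,k')` of the door. [cite: Yoshida1992HermitianForms, §7 pp. 305–312] -/
noncomputable def u2oReal (Sig a' E θ d0 : ℝ) (v : ℕ → ℝ) (B B3 : ℕ) (k k' : ℕ) : ℝ :=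
  (1 + θ) * (1 / (d0 * B3)) * (((-1 : ℝ) ^ (k + 1) * v k) * ((-1 : ℝ) ^ (k' + 1) * v k')) +
    (if k = k' then (1 + θ⁻¹) * (B / (d0 * ((((B3 : ℝ) + 1) ^ 2) * (B3 : ℝ)))) *
      (2 * ((k + 1 : ℕ) : ℝ) * Sig / π + ((((k + 1 : ℕ) : ℝ)) / 2 + 4 * a' * (1 + E) / (3 * π ^ 2))) ^ 2 else 0)

/-- Box of `U₂⁻(k,k')`. [cite: Yoshida1992HermitianForms, §7 pp. 305–312] -/
def u2O (S : ℕ) (C : Consts) (εs : List ℤ) (tab : List IdxRec) (d : OddCellData) (k k' : ℕ) : MI :=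
  let vk := (vBox S C εs (tget tab (k + 1))).mulInt (Encl.sgn k 1)
  let vk' := (vBox S C εs (tget tab (k' + 1))).mulInt (Encl.sgn k' 1)
  let cR := ((((vk.mul S vk').mulInt ((d.θD : ℤ) + d.θN)).divNat d.θD).mulInt ((2 : ℤ) ^ d.wbits)).divNat (d.d0N * d.B3)
  let κ := ((((sigBox S C).mul S C.invPi).mulInt (2 * ((k : ℤ) + 1))).add (MI.ofFrac S ((k : ℤ) + 1) 2)).add
    ((((d.CC.mul S C.invPi).mul S C.invPi).mulInt 4).divNat 3)
  let cD := (((((κ.mul S κ).mulInt ((d.θN : ℤ) + d.θD)).divNat d.θN).mulInt ((d.B : ℤ) * 2 ^ d.wbits)).divNat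
    (d.d0N * ((d.B3 + 1) ^ 2 * d.B3)))
  cR.add (if k = k' then cD else MI.ofInt S 0)

/-- Soundness of `u2O`. [cite: Moore1966, Ch. 3 (interval arithmetic: inclusion property)] -/
theorem mem_u2O (hS : 0 < S) {ks : List PrimeLen} (hks : PrimeData a ks) {C : Consts} (hC : ConstsValid S a ks C)
    (χ : DirichletCharacter ℂ q) {εs : List ℤ}
    (hε : ∀ i < ks.length, (χ (((ks.getD i default).val : ℕ) : ZMod q)).re = ((εs.getD i 0 : ℤ) : ℝ))
    {N : ℕ} {tab : List IdxRec} (hT : TabValid S a ks N tab)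
    {d : OddCellData} (hθN : 0 < d.θN) (hθD : 0 < d.θD) (hd0 : 0 < d.d0N) (hB3 : 1 ≤ d.B3) {E : ℝ}
    (hCC : MI.mem S (a * (1 + E)) d.CC) {k k' : ℕ} (hk : k + 1 < N) (hk' : k' + 1 < N) :
    MI.mem S (u2oReal (∑ j ∈ weilPrimeIndex a, (Λ j : ℝ) / Real.sqrt j) a E ((d.θN : ℝ) / d.θD)
      ((d.d0N : ℝ) / 2 ^ d.wbits) (vReal χ a) d.B d.B3 k k') (u2O S C εs tab d k k') := by
  have hSig := mem_sigBox hks hC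
  have hπ := hC.invPi
  have hvk : MI.mem S ((-1 : ℝ) ^ (k + 1) * vReal χ a k) ((vBox S C εs (tget tab (k + 1))).mulInt (Encl.sgn k 1)) := by
    refine mem_of_eq (MI.mem_mulInt (mem_vBox hS hks hC χ hε hT hk) _) ?_
    rw [show ((Encl.sgn k 1 : ℤ) : ℝ) = (-1 : ℝ) ^ ((k : ℤ) + 1) from (neg_one_zpow_eq_sgn k 1).symm,
      show ((k : ℤ) + 1) = ((k + 1 : ℕ) : ℤ) by push_cast; ring, zpow_natCast]
    ring
  have hvk' : MI.mem S ((-1 : ℝ) ^ (k' + 1) * vReal χ a k') ((vBox S C εs (tget tab (k' + 1))).mulInt (Encl.sgn k' 1)) := by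
    refine mem_of_eq (MI.mem_mulInt (mem_vBox hS hks hC χ hε hT hk') _) ?_
    rw [show ((Encl.sgn k' 1 : ℤ) : ℝ) = (-1 : ℝ) ^ ((k' : ℤ) + 1) from (neg_one_zpow_eq_sgn k' 1).symm,
      show ((k' : ℤ) + 1) = ((k' + 1 : ℕ) : ℤ) by push_cast; ring, zpow_natCast]
    ring
  have hθD' : (d.θD : ℝ) ≠ 0 := by exact_mod_cast hθD.ne'
  have hθN' : (d.θN : ℝ) ≠ 0 := by exact_mod_cast hθN.ne'
  have hd0' : (d.d0N : ℝ) ≠ 0 := by exact_mod_cast hd0.ne'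
  have hB3' : (d.B3 : ℝ) ≠ 0 := by exact_mod_cast (show d.B3 ≠ 0 by omega)
  have hcR : MI.mem S ((1 + (d.θN : ℝ) / d.θD) * (1 / ((d.d0N : ℝ) / 2 ^ d.wbits * d.B3)) *
      (((-1 : ℝ) ^ (k + 1) * vReal χ a k) * ((-1 : ℝ) ^ (k' + 1) * vReal χ a k')))
      (((((((vBox S C εs (tget tab (k + 1))).mulInt (Encl.sgn k 1)).mul S
        ((vBox S C εs (tget tab (k' + 1))).mulInt (Encl.sgn k' 1))).mulInt ((d.θD : ℤ) + d.θN)).divNat d.θD).mulInt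
        ((2 : ℤ) ^ d.wbits)).divNat (d.d0N * d.B3)) := by
    have h := MI.mem_divNat (MI.mem_mulInt (MI.mem_divNat (MI.mem_mulInt (MI.mem_mul hS hvk hvk') ((d.θD : ℤ) + d.θN))
      hθD) ((2 : ℤ) ^ d.wbits)) (n := d.d0N * d.B3) (Nat.mul_pos hd0 (by omega))
    refine mem_of_eq h ?_
    push_cast
    field_simp
  have hκ : MI.mem S (2 * ((k + 1 : ℕ) : ℝ) * (∑ j ∈ weilPrimeIndex a, (Λ j : ℝ) / Real.sqrt j) / π +
      (((k + 1 : ℕ) : ℝ) / 2 + 4 * a * (1 + E) / (3 * π ^ 2)))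
      (((((sigBox S C).mul S C.invPi).mulInt (2 * ((k : ℤ) + 1))).add (MI.ofFrac S ((k : ℤ) + 1) 2)).add
        ((((d.CC.mul S C.invPi).mul S C.invPi).mulInt 4).divNat 3)) := by
    refine mem_of_eq (MI.mem_add (MI.mem_add (MI.mem_mulInt (MI.mem_mul hS hSig hπ) (2 * ((k : ℤ) + 1)))
      (MI.mem_ofFrac S ((k : ℤ) + 1) (q := 2) (by norm_num)))
      (MI.mem_divNat (MI.mem_mulInt (MI.mem_mul hS (MI.mem_mul hS hCC hπ) hπ) 4) (n := 3) (by norm_num))) ?_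
    push_cast; ring
  have hcD : MI.mem S ((1 + ((d.θN : ℝ) / d.θD)⁻¹) * (d.B / ((d.d0N : ℝ) / 2 ^ d.wbits * ((((d.B3 : ℝ) + 1) ^ 2) * (d.B3 : ℝ)))) *
      (2 * ((k + 1 : ℕ) : ℝ) * (∑ j ∈ weilPrimeIndex a, (Λ j : ℝ) / Real.sqrt j) / π +
        (((k + 1 : ℕ) : ℝ) / 2 + 4 * a * (1 + E) / (3 * π ^ 2))) ^ 2)
      ((((((((((sigBox S C).mul S C.invPi).mulInt (2 * ((k : ℤ) + 1))).add (MI.ofFrac S ((k : ℤ) + 1) 2)).add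
        ((((d.CC.mul S C.invPi).mul S C.invPi).mulInt 4).divNat 3)).mul S
        (((((sigBox S C).mul S C.invPi).mulInt (2 * ((k : ℤ) + 1))).add (MI.ofFrac S ((k : ℤ) + 1) 2)).add
        ((((d.CC.mul S C.invPi).mul S C.invPi).mulInt 4).divNat 3))).mulInt ((d.θN : ℤ) + d.θD)).divNat d.θN).mulInt
        ((d.B : ℤ) * 2 ^ d.wbits)).divNat (d.d0N * ((d.B3 + 1) ^ 2 * d.B3))) := by
    have h := MI.mem_divNat (MI.mem_mulInt (MI.mem_divNat (MI.mem_mulInt (MI.mem_mul hS hκ hκ) ((d.θN : ℤ) + d.θD))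
      hθN) ((d.B : ℤ) * 2 ^ d.wbits)) (n := d.d0N * ((d.B3 + 1) ^ 2 * d.B3))
      (Nat.mul_pos hd0 (Nat.mul_pos (by positivity) (by omega)))
    refine mem_of_eq h ?_
    push_cast
    field_simp
  unfold u2O u2oReal
  refine MI.mem_add hcR ?_
  by_cases hkk : k = k'
  · subst hkk
    simp only [if_true]
    exact hcD
  · simp only [hkk, if_false]; simpa using MI.mem_ofInt S 0

/-! ## The door's `hSo` from a checked odd cell -/

/-- The boxed entry of the door's odd-sector matrix `S⁻(k,k')`. [cite: Yoshida1992HermitianForms, §7 pp. 305–312] -/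
def cellO (S : ℕ) (C : Consts) (εs : List ℤ) (LQ : MI) (tab : List IdxRec) (d : OddCellData) (k k' : ℕ) : MI :=
  ((oddBoxT S C εs LQ tab k k').sub (schurO S C εs LQ tab d.wbits d.wN d.B k k' (d.B3 - d.B))).sub (u2O S C εs tab d k k')

/-- Check integer data `D` against every boxed entry `S⁻(k,k')`, `k, k' < B`, and the data shape. [cite: Moore1966, Ch. 3 (interval arithmetic: inclusion property)] -/
def checkCellO (S : ℕ) (C : Consts) (εs : List ℤ) (LQ : MI) (tab : List IdxRec) (d : OddCellData) (c : ℕ) (ρ : ℤ)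
    (D : List (List ℤ)) : Bool :=
  decide (1 ≤ d.B) && decide (2 * d.B ≤ d.B3) && decide (0 < d.θN) && decide (0 < d.θD) && decide (0 < d.d0N) &&
    (List.range (d.B3 - d.B)).all (fun c' ↦ decide (0 < d.wN.getD c' 0)) &&
    (List.range d.B).all fun k ↦ (List.range d.B).all fun k' ↦
      enclCheck S c ρ (PsdDyadic.getMZ D k k') (cellO S C εs LQ tab d k k')

/-- Unpack `checkCellO`. [cite: Moore1966, Ch. 3 (interval arithmetic: inclusion property)] -/
theorem checkCellO_spec {C : Consts} {εs : List ℤ} {LQ : MI} {tab : List IdxRec} {d : OddCellData} {c : ℕ} {ρ : ℤ}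
    {D : List (List ℤ)} (h : checkCellO S C εs LQ tab d c ρ D = true) :
    1 ≤ d.B ∧ 2 * d.B ≤ d.B3 ∧ 0 < d.θN ∧ 0 < d.θD ∧ 0 < d.d0N ∧ (∀ c' < d.B3 - d.B, 0 < d.wN.getD c' 0) ∧
      ∀ k < d.B, ∀ k' < d.B, enclCheck S c ρ (PsdDyadic.getMZ D k k') (cellO S C εs LQ tab d k k') = true := by
  unfold checkCellO at h
  simp only [Bool.and_eq_true, decide_eq_true_eq, List.all_eq_true, List.mem_range] at h
  obtain ⟨⟨⟨⟨⟨⟨h1, h2⟩, h3⟩, h4⟩, h5⟩, h6⟩, h7⟩ := h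
  exact ⟨h1, h2, h3, h4, h5, h6, fun i hi j hj ↦ h7 i hi j hj⟩

/-- ★ **The door's odd-sector kernel fact `hSo` from a checked cell** (table valid below `N > B₃`), literally in the shape of
`weilPositivityOnChar_of_twisted_formatC_data` with `θo = θN/θD`, `d0o = d0N·2^{−wbits}`, `wo l = wN_{l−B}·2^{−wbits}`.
[cite: Yoshida1992HermitianForms, §7 pp. 305–312] -/
theorem hSo_of_checkCellO (hS : 0 < S) (ha0 : 0 < a) {ks : List PrimeLen} (hks : PrimeData a ks) {C : Consts}
    (hC : ConstsValid S a ks C) (χ : DirichletCharacter ℂ q) {εs : List ℤ}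
    (hε : ∀ i < ks.length, (χ (((ks.getD i default).val : ℕ) : ZMod q)).re = ((εs.getD i 0 : ℤ) : ℝ))
    {LQ : MI} (hLQ : MI.mem S (Real.log q) LQ) {N : ℕ} {tab : List IdxRec} (hT : TabValid S a ks N tab)
    {d : OddCellData} (hN : d.B3 < N) (hCC : MI.mem S (a * (1 + weilArchDensity (2 * a))) d.CC)
    {c : ℕ} {ρ δ : ℤ} {D L : List (List ℤ)} (hchk : checkCellO S C εs LQ tab d c ρ D = true)
    (hpsd : PsdDyadic.checkPsdMid d.B δ ρ D L = true) :
    ∀ x : Fin d.B → ℝ, 0 ≤ ∑ k, ∑ k', x k * x k' *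
      (((twistedGramCoeff χ a (((k : ℕ) : ℤ) + 1) (((k' : ℕ) : ℤ) + 1) - twistedGramCoeff χ a (((k : ℕ) : ℤ) + 1) (-(((k' : ℕ) : ℤ) + 1))) / 2)
        - (∑ l ∈ Finset.Ico d.B d.B3, ((twistedGramCoeff χ a (((k : ℕ) : ℤ) + 1) ((l : ℤ) + 1) - twistedGramCoeff χ a (((k : ℕ) : ℤ) + 1) (-((l : ℤ) + 1))) / 2) * ((twistedGramCoeff χ a (((k' : ℕ) : ℤ) + 1) ((l : ℤ) + 1) - twistedGramCoeff χ a (((k' : ℕ) : ℤ) + 1) (-((l : ℤ) + 1))) / 2) / ((d.wN.getD (l - d.B) 0 : ℝ) / 2 ^ d.wbits))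
        - ((1 + ((d.θN : ℝ) / d.θD)) * (1 / (((d.d0N : ℝ) / 2 ^ d.wbits) * d.B3)) * (((-1 : ℝ) ^ ((k : ℕ) + 1) * (-(∑ j ∈ weilPrimeIndex a, (χ (j : ZMod q)).re * ((Λ j : ℝ) / Real.sqrt j) * Real.sin (freq a (((k : ℕ) : ℤ) + 1) * Real.log j)) / π - (Complex.digamma (1 / 4 + ((freq a (((k : ℕ) : ℤ) + 1) : ℝ) : ℂ) / 2 * I)).im / (2 * π) + archExpSumSin a (((k : ℕ) : ℤ) + 1) / π)) * ((-1 : ℝ) ^ ((k' : ℕ) + 1) * (-(∑ j ∈ weilPrimeIndex a, (χ (j : ZMod q)).re * ((Λ j : ℝ) / Real.sqrt j) * Real.sin (freq a (((k' : ℕ) : ℤ) + 1) * Real.log j)) / π - (Complex.digamma (1 / 4 + ((freq a (((k' : ℕ) : ℤ) + 1) : ℝ) : ℂ) / 2 * I)).im / (2 * π) + archExpSumSin a (((k' : ℕ) : ℤ) + 1) / π))) + (if k = k' then (1 + ((d.θN : ℝ) / d.θD)⁻¹) * (d.B / (((d.d0N : ℝ) / 2 ^ d.wbits) * ((((d.B3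 : ℝ) + 1) ^ 2) * (d.B3 : ℝ)))) * (2 * ((k : ℕ) + 1 : ℕ) * (∑ j ∈ weilPrimeIndex a, (Λ j : ℝ) / Real.sqrt j) / π + ((((k : ℕ) + 1 : ℕ) : ℝ) / 2 + 4 * a * (1 + weilArchDensity (2 * a)) / (3 * π ^ 2))) ^ 2 else 0))) := by
  obtain ⟨hB1, hBB3, hθN, hθD, hd0, hw, hrows⟩ := checkCellO_spec hchk
  set G : ℤ → ℤ → ℝ := twistedGramCoeff χ a with hG
  set Sig : ℝ := ∑ j ∈ weilPrimeIndex a, (Λ j : ℝ) / Real.sqrt j with hSigdef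
  set Sr : ℕ → ℕ → ℝ := fun k k' ↦ oddKernel G k k' -
      (∑ c' ∈ Finset.range (d.B3 - d.B), oddKernel G k (d.B + c') * oddKernel G k' (d.B + c') /
        ((d.wN.getD c' 0 : ℝ) / 2 ^ d.wbits)) -
      u2oReal Sig a (weilArchDensity (2 * a)) ((d.θN : ℝ) / d.θD) ((d.d0N : ℝ) / 2 ^ d.wbits) (vReal χ a) d.B d.B3 k k'
    with hSr
  have hmem : ∀ k < d.B, ∀ k' < d.B, MI.mem S (Sr k k') (cellO S C εs LQ tab d k k') := by
    intro k hk k' hk'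
    have hkN : k + 1 < N := by omega
    have hkN' : k' + 1 < N := by omega
    exact MI.mem_sub (MI.mem_sub (mem_oddBoxT hS ha0 hks hC χ hε hLQ hT hkN hkN')
      (mem_schurO hS ha0 hks hC χ hε hLQ hT hkN hkN' (d.B3 - d.B) (by omega) hw))
      (mem_u2O hS hks hC χ hε hT hθN hθD hd0 (by omega) hCC hkN hkN')
  have hnear : ∀ i j : Fin d.B, |Sr i j - (PsdDyadic.getMZ D i j : ℝ) * (1 / 2 ^ c)| ≤ (ρ : ℝ) * (1 / 2 ^ c) :=
    fun i j ↦ abs_sub_le_of_enclCheck hS (hrows i i.isLt j j.isLt) (hmem i i.isLt j j.isLt)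
  have hpsd' := PsdDyadic.psd_of_checkPsdMid hpsd (u := 1 / 2 ^ c) (by positivity) (fun i j ↦ Sr i j) hnear
  intro x
  have key := hpsd' x
  have hIco : ∀ (f : ℕ → ℝ), ∑ m ∈ Finset.Ico d.B d.B3, f m = ∑ c' ∈ Finset.range (d.B3 - d.B), f (d.B + c') :=
    fun f ↦ Finset.sum_Ico_eq_sum_range f d.B d.B3
  refine key.trans_eq (Finset.sum_congr rfl fun k _ ↦ Finset.sum_congr rfl fun k' _ ↦ ?_)
  congr 1
  simp only [hSr, hG, hSigdef, oddKernel, u2oReal, vReal, hIco, Nat.add_sub_cancel_left, Fin.val_inj, Nat.cast_add,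
    Nat.cast_one]

end TwistedEncl

end Summit.Ventures.WeilGRH
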